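import Summits.Ventures.CertifiedManyBodySolver.Upper.UMPSDualBoundBridge
import Literature.MathematicalPhysics.QuantumLattice.HubbardJordanWigner

/-!
# uMPS upper bound for the Hubbard chain, III: blocking two sites into one cell

HONEST FRAMING: first certified bounds; not a superconductivity verdict; every number certified or
labelled float.

Venture `Ventures/CertifiedManyBodySolver` (sr-mbsolver). VAR's uMPS certificates of record
(`certs/var/umps1d/FORMAT-umps1.md`, `ncell = 2`) are uniform MPS on TWO-SITE CELLS: physical
dimension `d = 16`, super-site index `S = 4 k₀ + k₁` (`k₀` = left site, `k₁` = right site of the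
cell), cell bond matrix `hh` on `ℂ¹⁶ ⊗ ℂ¹⁶`, claim `2 e(t,U) ≤ q`. Theorem U1 for one-site cells is
`Upper/UMPSEnergyBound.lean` (`hubbardChainEnergyDensity_le_of_umps_dual`); the tensor side
(`Upper/UMPSDualBound.lean`) is generic in the physical dimension `q`, so the cell version only
needs the purely combinatorial BLOCKING of the Jordan–Wigner qudit chain `Op (Fin (C·2)) 4` into the
chain of cells `Op (Fin C) 16`, which is this file:

* `cellIndex : Fin 4 × Fin 4 ≃ Fin 16`, `(k₀, k₁) ↦ 4 k₀ + k₁`; `cellOp` = the induced algebra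
  isomorphism `Matrix (Fin 4 × Fin 4) ≃ₐ Matrix (Fin 16)` (so `cellOp (M₀ ⊗ₖ M₁)` is "`M₀` on the
  left site, `M₁` on the right site");
* `site C m i : Fin (C·2)` = site `2 m + i`; `blockCfg C : TensorIndex (Fin (C·2)) 4 ≃ TensorIndex (Fin C) 16`
  and `blockOp C : Op (Fin (C·2)) 4 ≃ₐ[ℂ] Op (Fin C) 16` (reindexing);
* `blockOp_onSite_zero / _one` — a one-site operator on the left/right site of cell `m` blocks to
  `onSite m (cellOp (M ⊗ₖ 1))` / `onSite m (cellOp (1 ⊗ₖ M))`;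
* `blockOp_intra` — an intra-cell two-site word blocks to `onSite m (cellOp (M₀ ⊗ₖ M₁))`;
* `blockOp_inter` — an inter-cell word (right site of cell `x`, left site of cell `x+1`) blocks to
  `twoSiteOp x (cellOp (1 ⊗ₖ M₁) ⊗ₖ cellOp (M₂ ⊗ₖ 1))` (`twoSiteOp` of `UMPSDualBound`);
* `sum_sites_eq_sum_cells`, `sum_sum_ite_val_succ_sites` — site sums and nearest-neighbour bond sums
  of the `(n+2)·2`-site chain as cell sums: `n + 2` intra-cell bonds and `n + 1` inter-cell bonds.

Physical-index convention on each site: the tree's (`0 = ∅, 1 = ↑, 2 = ↓, 3 = ↑↓`); VAR's files use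
`s = 2 n↑ + n↓` per site (swap `1 ↔ 2` on each leg before forming `S = 4 s₁ + s₂`).
-/

noncomputable section
open Matrix Finset
open scoped ComplexOrder BigOperators Kronecker

namespace Summit.Ventures.CertifiedManyBodySolver.Upper
open Literature.MathematicalPhysics.QuantumLattice

/-! ### Cells of two sites -/

/-- The super-site (cell) index `(k₀, k₁) ↦ 4 k₀ + k₁ ∈ Fin 16` of a two-site cell
(`k₀` = left site, `k₁` = right site; VAR's `S = 4 s₁ + s₂`). -/
def cellIndex : Fin 4 × Fin 4 ≃ Fin 16 := finProdFinEquiv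

/-- `cellIndex (k₀, k₁) = 4 k₀ + k₁` (as a natural number: `k₁ + 4 k₀`). -/
theorem cellIndex_val (k₀ k₁ : Fin 4) : (cellIndex (k₀, k₁)).val = (k₁ : ℕ) + 4 * k₀ := by
  simp [cellIndex, finProdFinEquiv]

/-- A two-site matrix (rows/columns `Fin 4 × Fin 4`) read as a one-cell `16 × 16` matrix. -/
def cellOp : Matrix (Fin 4 × Fin 4) (Fin 4 × Fin 4) ℂ ≃ₐ[ℂ] Matrix (Fin 16) (Fin 16) ℂ :=
  Matrix.reindexAlgEquiv ℂ ℂ cellIndex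

/-- Entries of `cellOp M`. -/
theorem cellOp_apply (M : Matrix (Fin 4 × Fin 4) (Fin 4 × Fin 4) ℂ) (S S' : Fin 16) :
    cellOp M S S' = M (cellIndex.symm S) (cellIndex.symm S') := rfl

/-- `cellOp` commutes with the conjugate transpose. -/
theorem cellOp_conjTranspose (M : Matrix (Fin 4 × Fin 4) (Fin 4 × Fin 4) ℂ) :
    cellOp Mᴴ = (cellOp M)ᴴ := by
  ext S S'
  simp [cellOp_apply, Matrix.conjTranspose_apply]

/-- `cellOp` preserves positive semidefiniteness (it is a reindexing along an equivalence). -/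
theorem posSemidef_cellOp_iff (M : Matrix (Fin 4 × Fin 4) (Fin 4 × Fin 4) ℂ) :
    (cellOp M).PosSemidef ↔ M.PosSemidef :=
  Matrix.posSemidef_submatrix_equiv cellIndex.symm

/-- Site `i ∈ {0, 1}` of cell `m` in the open chain of `C · 2` sites: `2 m + i`. -/
def site (C : ℕ) (m : Fin C) (i : Fin 2) : Fin (C * 2) := finProdFinEquiv (m, i)

/-- `(site C m i).val = 2 m + i`. -/
theorem site_val (C : ℕ) (m : Fin C) (i : Fin 2) : (site C m i).val = (i : ℕ) + 2 * m := by
  simp [site, finProdFinEquiv]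

/-- `site` is injective in `(m, i)`. -/
theorem site_injective_iff {C : ℕ} {m m' : Fin C} {i i' : Fin 2} :
    site C m i = site C m' i' ↔ m = m' ∧ i = i' := by
  simp [site, Prod.ext_iff]

/-- Blocking of configurations: a configuration of the `C · 2` sites ↦ the configuration of the
`C` cells (`cell m ↦ cellIndex (σ (2m), σ (2m+1))`). -/
def blockCfg (C : ℕ) : TensorIndex (Fin (C * 2)) 4 ≃ TensorIndex (Fin C) 16 where
  toFun σ := fun m => cellIndex (σ (site C m 0), σ (site C m 1))
  invFun κ := fun j =>
    if (finProdFinEquiv.symm j).2 = 0 then (cellIndex.symm (κ (finProdFinEquiv.symm j).1)).1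
    else (cellIndex.symm (κ (finProdFinEquiv.symm j).1)).2
  left_inv σ := by
    funext j
    simp only [site]
    obtain ⟨⟨m, i⟩, rfl⟩ := finProdFinEquiv.surjective j
    simp only [Equiv.symm_apply_apply]
    fin_cases i <;> simp
  right_inv κ := by
    funext m
    simp [site]

/-- `blockCfg C σ m = cellIndex (σ (m,0), σ (m,1))`. -/
theorem blockCfg_apply (C : ℕ) (σ : TensorIndex (Fin (C * 2)) 4) (m : Fin C) :
    blockCfg C σ m = cellIndex (σ (site C m 0), σ (site C m 1)) := rfl

/-- The unblocked configuration at the sites of cell `m` is read off the cell index. -/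
theorem blockCfg_symm_apply_site (C : ℕ) (κ : TensorIndex (Fin C) 16) (m : Fin C) (i : Fin 2) :
    (blockCfg C).symm κ (site C m i) =
      if i = 0 then (cellIndex.symm (κ m)).1 else (cellIndex.symm (κ m)).2 := by
  change (if (finProdFinEquiv.symm (finProdFinEquiv (m, i))).2 = 0 then
      (cellIndex.symm (κ (finProdFinEquiv.symm (finProdFinEquiv (m, i))).1)).1
    else (cellIndex.symm (κ (finProdFinEquiv.symm (finProdFinEquiv (m, i))).1)).2) = _
  rw [Equiv.symm_apply_apply]

/-- Left site of cell `m`: first component of the cell index. -/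
theorem blockCfg_symm_apply_site_zero (C : ℕ) (κ : TensorIndex (Fin C) 16) (m : Fin C) :
    (blockCfg C).symm κ (site C m 0) = (cellIndex.symm (κ m)).1 := by
  rw [blockCfg_symm_apply_site, if_pos rfl]

/-- Right site of cell `m`: second component of the cell index. -/
theorem blockCfg_symm_apply_site_one (C : ℕ) (κ : TensorIndex (Fin C) 16) (m : Fin C) :
    (blockCfg C).symm κ (site C m 1) = (cellIndex.symm (κ m)).2 := by
  rw [blockCfg_symm_apply_site, if_neg (by decide)]

/-- Blocking of operators: `Op (Fin (C·2)) 4 ≃ₐ Op (Fin C) 16` (reindexing along `blockCfg`). -/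
def blockOp (C : ℕ) : Op (Fin (C * 2)) 4 ≃ₐ[ℂ] Op (Fin C) 16 :=
  Matrix.reindexAlgEquiv ℂ ℂ (blockCfg C)

/-- Entries of `blockOp C O`. -/
theorem blockOp_apply (C : ℕ) (O : Op (Fin (C * 2)) 4) (κ κ' : TensorIndex (Fin C) 16) :
    blockOp C O κ κ' = O ((blockCfg C).symm κ) ((blockCfg C).symm κ') := rfl

/-- Quadratic forms are invariant under blocking: `⟨φ∘b⁻¹, blockOp O (ψ∘b⁻¹)⟩ = ⟨φ, O ψ⟩`
(`b = blockCfg C`). -/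
theorem star_dotProduct_blockOp_mulVec (C : ℕ) (O : Op (Fin (C * 2)) 4)
    (φ ψ : TensorIndex (Fin (C * 2)) 4 → ℂ) :
    star (fun κ => φ ((blockCfg C).symm κ)) ⬝ᵥ
        (blockOp C O *ᵥ fun κ => ψ ((blockCfg C).symm κ)) = star φ ⬝ᵥ (O *ᵥ ψ) := by
  simp only [dotProduct, Matrix.mulVec, Pi.star_apply, blockOp_apply]
  rw [← Equiv.sum_comp (blockCfg C).symm]
  refine Finset.sum_congr rfl fun κ _ => ?_
  congr 1
  exact Equiv.sum_comp (blockCfg C).symm (fun σ' => O ((blockCfg C).symm κ) σ' * ψ σ')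

/-- Quadratic forms along blocking, cell-side form: for vectors `φ, ψ` on the CELL chain,
`⟨φ∘b, O (ψ∘b)⟩ = ⟨φ, blockOp O ψ⟩` (`b = blockCfg C`). -/
theorem star_comp_blockCfg_dotProduct_mulVec (C : ℕ) (O : Op (Fin (C * 2)) 4)
    (φ ψ : TensorIndex (Fin C) 16 → ℂ) :
    star (fun σ => φ (blockCfg C σ)) ⬝ᵥ (O *ᵥ fun σ => ψ (blockCfg C σ)) =
      star φ ⬝ᵥ (blockOp C O *ᵥ ψ) := by
  have h := star_dotProduct_blockOp_mulVec C O (fun σ => φ (blockCfg C σ))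
    (fun σ => ψ (blockCfg C σ))
  simp only [Equiv.apply_symm_apply] at h
  exact h.symm

/-- Agreement of two unblocked configurations off the site `(m, 0)`. -/
theorem forall_ne_site_zero_iff (C : ℕ) (κ κ' : TensorIndex (Fin C) 16) (m : Fin C) :
    (∀ y, y ≠ site C m 0 → (blockCfg C).symm κ y = (blockCfg C).symm κ' y) ↔
      ((∀ m', m' ≠ m → κ m' = κ' m') ∧ (cellIndex.symm (κ m)).2 = (cellIndex.symm (κ' m)).2) := by
  constructor
  · intro h
    refine ⟨fun m' hm' => ?_, ?_⟩
    · have h0 := h (site C m' 0) (fun he => hm' (site_injective_iff.1 he).1)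
      have h1 := h (site C m' 1) (fun he => hm' (site_injective_iff.1 he).1)
      rw [blockCfg_symm_apply_site_zero, blockCfg_symm_apply_site_zero] at h0
      rw [blockCfg_symm_apply_site_one, blockCfg_symm_apply_site_one] at h1
      exact cellIndex.symm.injective (Prod.ext h0 h1)
    · have h1 := h (site C m 1) (fun he => absurd (site_injective_iff.1 he).2 (by decide))
      rwa [blockCfg_symm_apply_site_one, blockCfg_symm_apply_site_one] at h1
  · rintro ⟨hR, hc⟩ y hy
    obtain ⟨⟨m', i'⟩, rfl⟩ := finProdFinEquiv.surjective y
    change site C m' i' ≠ site C m 0 at hy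
    change (blockCfg C).symm κ (site C m' i') = (blockCfg C).symm κ' (site C m' i')
    rw [blockCfg_symm_apply_site, blockCfg_symm_apply_site]
    by_cases hm' : m' = m
    · subst hm'
      have hi' : i' ≠ 0 := fun h => hy (by rw [h])
      rw [if_neg hi', if_neg hi', hc]
    · rw [hR m' hm']

/-- Agreement of two unblocked configurations off the site `(m, 1)`. -/
theorem forall_ne_site_one_iff (C : ℕ) (κ κ' : TensorIndex (Fin C) 16) (m : Fin C) :
    (∀ y, y ≠ site C m 1 → (blockCfg C).symm κ y = (blockCfg C).symm κ' y) ↔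
      ((∀ m', m' ≠ m → κ m' = κ' m') ∧ (cellIndex.symm (κ m)).1 = (cellIndex.symm (κ' m)).1) := by
  constructor
  · intro h
    refine ⟨fun m' hm' => ?_, ?_⟩
    · have h0 := h (site C m' 0) (fun he => hm' (site_injective_iff.1 he).1)
      have h1 := h (site C m' 1) (fun he => hm' (site_injective_iff.1 he).1)
      rw [blockCfg_symm_apply_site_zero, blockCfg_symm_apply_site_zero] at h0
      rw [blockCfg_symm_apply_site_one, blockCfg_symm_apply_site_one] at h1
      exact cellIndex.symm.injective (Prod.ext h0 h1)
    · have h0 := h (site C m 0) (fun he => absurd (site_injective_iff.1 he).2 (by decide))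
      rwa [blockCfg_symm_apply_site_zero, blockCfg_symm_apply_site_zero] at h0
  · rintro ⟨hR, hc⟩ y hy
    obtain ⟨⟨m', i'⟩, rfl⟩ := finProdFinEquiv.surjective y
    change site C m' i' ≠ site C m 1 at hy
    change (blockCfg C).symm κ (site C m' i') = (blockCfg C).symm κ' (site C m' i')
    rw [blockCfg_symm_apply_site, blockCfg_symm_apply_site]
    by_cases hm' : m' = m
    · subst hm'
      have hi' : i' ≠ 1 := fun h => hy (by rw [h])
      have hi0 : i' = 0 := by
        rcases Fin.exists_fin_two.mp ⟨i', rfl⟩ with h | h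
        · exact h
        · exact absurd h hi'
      rw [if_pos hi0, if_pos hi0, hc]
    · rw [hR m' hm']

/-- **Blocking a single-site operator on the LEFT site of a cell**:
`blockOp (onSite (m,0) M) = onSite m (cellOp (M ⊗ 1))`. -/
theorem blockOp_onSite_zero (C : ℕ) (m : Fin C) (M : Matrix (Fin 4) (Fin 4) ℂ) :
    blockOp C (onSite (site C m 0) M) = onSite m (cellOp (M ⊗ₖ (1 : Matrix (Fin 4) (Fin 4) ℂ))) := by
  ext κ κ'
  have hL : blockOp C (onSite (site C m 0) M) κ κ' =
      if (∀ y, y ≠ site C m 0 → (blockCfg C).symm κ y = (blockCfg C).symm κ' y) then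
        M ((cellIndex.symm (κ m)).1) ((cellIndex.symm (κ' m)).1) else 0 := by
    rw [blockOp_apply, onSite_apply]
    simp only [blockCfg_symm_apply_site_zero]
  have hR' : (onSite m (cellOp (M ⊗ₖ (1 : Matrix (Fin 4) (Fin 4) ℂ))) : Op (Fin C) 16) κ κ' =
      if (∀ m', m' ≠ m → κ m' = κ' m') then
        M ((cellIndex.symm (κ m)).1) ((cellIndex.symm (κ' m)).1) *
          (if (cellIndex.symm (κ m)).2 = (cellIndex.symm (κ' m)).2 then 1 else 0) else 0 := by
    rw [onSite_apply]
    simp only [cellOp_apply, Matrix.kroneckerMap_apply, Matrix.one_apply]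
  rw [hL, hR']
  by_cases h : ∀ y, y ≠ site C m 0 → (blockCfg C).symm κ y = (blockCfg C).symm κ' y
  · obtain ⟨hR, hc⟩ := (forall_ne_site_zero_iff C κ κ' m).1 h
    rw [if_pos h, if_pos hR, if_pos hc, mul_one]
  · rw [if_neg h]
    by_cases hR : ∀ m', m' ≠ m → κ m' = κ' m'
    · have hc : ¬ (cellIndex.symm (κ m)).2 = (cellIndex.symm (κ' m)).2 := fun hc =>
        h ((forall_ne_site_zero_iff C κ κ' m).2 ⟨hR, hc⟩)
      rw [if_pos hR, if_neg hc, mul_zero]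
    · rw [if_neg hR]

/-- **Blocking a single-site operator on the RIGHT site of a cell**:
`blockOp (onSite (m,1) M) = onSite m (cellOp (1 ⊗ M))`. -/
theorem blockOp_onSite_one (C : ℕ) (m : Fin C) (M : Matrix (Fin 4) (Fin 4) ℂ) :
    blockOp C (onSite (site C m 1) M) = onSite m (cellOp ((1 : Matrix (Fin 4) (Fin 4) ℂ) ⊗ₖ M)) := by
  ext κ κ'
  have hL : blockOp C (onSite (site C m 1) M) κ κ' =
      if (∀ y, y ≠ site C m 1 → (blockCfg C).symm κ y = (blockCfg C).symm κ' y) then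
        M ((cellIndex.symm (κ m)).2) ((cellIndex.symm (κ' m)).2) else 0 := by
    rw [blockOp_apply, onSite_apply]
    simp only [blockCfg_symm_apply_site_one]
  have hR' : (onSite m (cellOp ((1 : Matrix (Fin 4) (Fin 4) ℂ) ⊗ₖ M)) : Op (Fin C) 16) κ κ' =
      if (∀ m', m' ≠ m → κ m' = κ' m') then
        (if (cellIndex.symm (κ m)).1 = (cellIndex.symm (κ' m)).1 then 1 else 0) *
          M ((cellIndex.symm (κ m)).2) ((cellIndex.symm (κ' m)).2) else 0 := by
    rw [onSite_apply]
    simp only [cellOp_apply, Matrix.kroneckerMap_apply, Matrix.one_apply]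
  rw [hL, hR']
  by_cases h : ∀ y, y ≠ site C m 1 → (blockCfg C).symm κ y = (blockCfg C).symm κ' y
  · obtain ⟨hR, hc⟩ := (forall_ne_site_one_iff C κ κ' m).1 h
    rw [if_pos h, if_pos hR, if_pos hc, one_mul]
  · rw [if_neg h]
    by_cases hR : ∀ m', m' ≠ m → κ m' = κ' m'
    · have hc : ¬ (cellIndex.symm (κ m)).1 = (cellIndex.symm (κ' m)).1 := fun hc =>
        h ((forall_ne_site_one_iff C κ κ' m).2 ⟨hR, hc⟩)
      rw [if_pos hR, if_neg hc, zero_mul]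
    · rw [if_neg hR]

/-- An INTRA-cell two-site word blocks to a one-cell operator:
`blockOp (onSite (m,0) M₀ · onSite (m,1) M₁) = onSite m (cellOp (M₀ ⊗ M₁))`. -/
theorem blockOp_intra (C : ℕ) (m : Fin C) (M₀ M₁ : Matrix (Fin 4) (Fin 4) ℂ) :
    blockOp C (onSite (site C m 0) M₀ * onSite (site C m 1) M₁) = onSite m (cellOp (M₀ ⊗ₖ M₁)) := by
  rw [map_mul, blockOp_onSite_zero, blockOp_onSite_one, onSite_mul, ← map_mul,
    ← Matrix.mul_kronecker_mul, Matrix.mul_one, Matrix.one_mul]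

/-- An INTER-cell two-site word (right site of cell `x`, left site of cell `x + 1`) blocks to a
two-cell word:
`blockOp (onSite (x,1) M₁ · onSite (x+1,0) M₂) = twoSiteOp x (cellOp (1 ⊗ M₁) ⊗ cellOp (M₂ ⊗ 1))`. -/
theorem blockOp_inter (n : ℕ) (x : Fin (n + 1)) (M₁ M₂ : Matrix (Fin 4) (Fin 4) ℂ) :
    blockOp (n + 2) (onSite (site (n + 2) ⟨x, by omega⟩ 1) M₁ *
        onSite (site (n + 2) ⟨x + 1, by omega⟩ 0) M₂) =
      twoSiteOp (n + 2) x (by omega)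
        (cellOp ((1 : Matrix (Fin 4) (Fin 4) ℂ) ⊗ₖ M₁) ⊗ₖ
          cellOp (M₂ ⊗ₖ (1 : Matrix (Fin 4) (Fin 4) ℂ))) := by
  rw [map_mul, blockOp_onSite_one, blockOp_onSite_zero, twoSiteOp_kronecker]

/-! ### Site sums as cell sums -/

/-- `Σ_{sites} f = Σ_{cells} (f(m,0) + f(m,1))`. -/
theorem sum_sites_eq_sum_cells {M : Type*} [AddCommMonoid M] (C : ℕ) (f : Fin (C * 2) → M) :
    ∑ i, f i = ∑ m : Fin C, (f (site C m 0) + f (site C m 1)) := by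
  rw [← Equiv.sum_comp finProdFinEquiv, Fintype.sum_prod_type]
  refine Finset.sum_congr rfl fun m _ => ?_
  rw [Fin.sum_univ_two]
  rfl

/-- The nearest-neighbour bonds of the chain of `(n+2)·2` sites are the `n + 2` intra-cell bonds
`((m,0),(m,1))` and the `n + 1` inter-cell bonds `((x,1),(x+1,0))`. -/
theorem sum_sum_ite_val_succ_sites {M : Type*} [AddCommMonoid M] (n : ℕ)
    (w : Fin ((n + 2) * 2) → Fin ((n + 2) * 2) → M) :
    (∑ i, ∑ j, if i.val + 1 = j.val then w i j else 0) =
      ∑ m : Fin (n + 2), w (site (n + 2) m 0) (site (n + 2) m 1) +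
        ∑ x : Fin (n + 1), w (site (n + 2) ⟨x, by omega⟩ 1) (site (n + 2) ⟨x + 1, by omega⟩ 0) := by
  -- the inner sum at a left site `(m,0)`: only `j = (m,1)` contributes
  have h0 : ∀ m : Fin (n + 2),
      (∑ j, if (site (n + 2) m 0).val + 1 = j.val then w (site (n + 2) m 0) j else 0) =
        w (site (n + 2) m 0) (site (n + 2) m 1) := by
    intro m
    rw [Finset.sum_eq_single (site (n + 2) m 1)]
    · rw [if_pos (by rw [site_val, site_val]; simp; omega)]
    · intro j _ hj
      rw [if_neg]
      intro h
      apply hj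
      apply Fin.ext
      rw [site_val] at h ⊢
      simp at h ⊢
      omega
    · intro h; exact absurd (Finset.mem_univ _) h
  -- the inner sum at a right site `(m,1)`: only `j = (m+1,0)` contributes (if it exists)
  have h1 : ∀ m : Fin (n + 2),
      (∑ j, if (site (n + 2) m 1).val + 1 = j.val then w (site (n + 2) m 1) j else 0) =
        if h : m.val + 1 < n + 2 then w (site (n + 2) m 1) (site (n + 2) ⟨m.val + 1, h⟩ 0)
        else 0 := by
    intro m
    by_cases h : m.val + 1 < n + 2
    · rw [dif_pos h, Finset.sum_eq_single (site (n + 2) ⟨m.val + 1, h⟩ 0)]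
      · rw [if_pos (by rw [site_val, site_val]; simp; omega)]
      · intro j _ hj
        rw [if_neg]
        intro h'
        apply hj
        apply Fin.ext
        rw [site_val] at h' ⊢
        simp at h' ⊢
        omega
      · intro h'; exact absurd (Finset.mem_univ _) h'
    · rw [dif_neg h]
      refine Finset.sum_eq_zero fun j _ => ?_
      rw [if_neg]
      intro h'
      rw [site_val] at h'
      have := j.isLt
      simp at h'
      omega
  rw [sum_sites_eq_sum_cells, Finset.sum_add_distrib]
  simp only [h0, h1]
  congr 1
  rw [Fin.sum_univ_castSucc]
  have hlast : ¬ ((Fin.last (n + 1)).val + 1 < n + 2) := by simp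
  rw [dif_neg hlast, add_zero]
  refine Finset.sum_congr rfl fun x _ => ?_
  rw [dif_pos (by simp; omega)]
  rfl

end Summit.Ventures.CertifiedManyBodySolver.Upper
end
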